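import Mathlib
import Summits.RiemannHypothesis.RiemannHypothesis.Theorems.DensityLadderSeparatedTowerGaussian
import HarnessLib

/-!
# `DensityLadder.SeparatedTowerDensityLine` (item stmt-RiemannHypothesis-24918) — real Gaussian
# moments for the upper bound (step (g) of stub S1)

LINE L57 «sieve sight above the density line» (rh-idea-10 g1), crux K1 `SeparatedTowerDensityLine`,
stub S1 of the registered skeleton `Birth.lean`, step (g) of the mean-value argument (seat memo
`MEANVALUE-SECOND-READ.md` on stmt-RiemannHypothesis-24918).  The pointwise majorant
`|S(e^u)| ≤ C_a(e^u u + e^U u)` is squared and integrated against `G_L(u−U) = e^{−(u−U)²/(2L²)}`;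
this needs the real tilted Gaussian integrals `∫ e^{au} G_L(u−U) du = √(2π)L e^{aU + a²L²/2}` and
the second-moment bound `∫ u² e^{au} G_L(u−U) du ≤ √(2π)(2U²L e^{aU+a²L²/2} + 8√2 L³ e^{aU+a²L²})`
(from `u² ≤ 2U² + 2(u−U)²` and `(u−U)² ≤ 4L² e^{(u−U)²/(4L²)}`).
Cell rh-split, seat rh-split-prover-l57 g0.  RH-free, ζ-free; FRONTIER bookkeeping; nothing here
bears on the truth of RH.
-/

set_option linter.dupNamespace false

noncomputable section

open Complex Filter Set MeasureTheory Topology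
open scoped Real

namespace Summit.RiemannHypothesis.RiemannHypothesis.Theorems.DensityLadderSeparatedTowerGaussianReal

open Summit.RiemannHypothesis.RiemannHypothesis.Theorems.DensityLadderSeparatedTowerGaussian

/-- **Real tilted Gaussian integral**: `∫ e^{au} e^{−(u−U)²/(2L²)} du = √(2π) L e^{aU + a²L²/2}`.
[folklore] -/
theorem integral_exp_mul_gaussian (a : ℝ) {L : ℝ} (hL : 0 < L) (U : ℝ) :
    ∫ u : ℝ, Real.exp (a * u) * Real.exp (-(u - U) ^ 2 / (2 * L ^ 2)) =
      Real.sqrt (2 * π) * L * Real.exp (a * U + a ^ 2 * L ^ 2 / 2) := by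
  have h := integral_cexp_mul_gaussian (a : ℂ) hL U
  have hlhs : ∫ u : ℝ, cexp ((a : ℂ) * u) * (Real.exp (-(u - U) ^ 2 / (2 * L ^ 2)) : ℂ) =
      ((∫ u : ℝ, Real.exp (a * u) * Real.exp (-(u - U) ^ 2 / (2 * L ^ 2)) : ℝ) : ℂ) := by
    rw [← integral_complex_ofReal]
    refine integral_congr_ae (Eventually.of_forall fun u ↦ ?_)
    push_cast
    ring_nf
  have hrhs : ((Real.sqrt (2 * π) * L : ℝ) : ℂ) * cexp ((a : ℂ) * U + (a : ℂ) ^ 2 * L ^ 2 / 2) =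
      ((Real.sqrt (2 * π) * L * Real.exp (a * U + a ^ 2 * L ^ 2 / 2) : ℝ) : ℂ) := by
    push_cast
    ring_nf
  rw [hlhs, hrhs] at h
  exact_mod_cast h

/-- The real tilted Gaussian is integrable. [folklore] -/
theorem integrable_exp_mul_gaussian (a : ℝ) {L : ℝ} (hL : 0 < L) (U : ℝ) :
    Integrable fun u : ℝ ↦ Real.exp (a * u) * Real.exp (-(u - U) ^ 2 / (2 * L ^ 2)) := by
  have h := (integrable_cexp_mul_gaussian (a : ℂ) hL U).norm
  refine h.congr (Eventually.of_forall fun u ↦ ?_)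
  simp only
  rw [norm_mul, Complex.norm_exp, Complex.norm_real, Real.norm_of_nonneg (Real.exp_pos _).le]
  congr 2
  simp

/-- `x² ≤ 4L² e^{x²/(4L²)}` (from `y ≤ e^y`). [folklore] -/
theorem sq_le_gauss_inv {L : ℝ} (hL : 0 < L) (x : ℝ) :
    x ^ 2 ≤ 4 * L ^ 2 * Real.exp (x ^ 2 / (4 * L ^ 2)) := by
  have h := Real.add_one_le_exp (x ^ 2 / (4 * L ^ 2))
  have hL2 : 0 < 4 * L ^ 2 := by positivity
  have hx0 : 0 ≤ x ^ 2 / (4 * L ^ 2) := by positivity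
  calc x ^ 2 = 4 * L ^ 2 * (x ^ 2 / (4 * L ^ 2)) := by field_simp
    _ ≤ 4 * L ^ 2 * Real.exp (x ^ 2 / (4 * L ^ 2)) :=
        mul_le_mul_of_nonneg_left (by linarith) hL2.le

/-- **Second moment against the tilted Gaussian**: for `a`, `U` real and `L > 0`,
`∫ u² e^{au} e^{−(u−U)²/(2L²)} du ≤ 2U² √(2π) L e^{aU+a²L²/2} + 8L² √(2π) (√2 L) e^{aU + a²L²}`
(and the integrand is integrable). [folklore] -/
theorem integral_sq_mul_exp_mul_gaussian_le (a : ℝ) {L : ℝ} (hL : 0 < L) (U : ℝ) :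
    Integrable (fun u : ℝ ↦ u ^ 2 * Real.exp (a * u) * Real.exp (-(u - U) ^ 2 / (2 * L ^ 2))) ∧
    ∫ u : ℝ, u ^ 2 * Real.exp (a * u) * Real.exp (-(u - U) ^ 2 / (2 * L ^ 2)) ≤
      2 * U ^ 2 * (Real.sqrt (2 * π) * L * Real.exp (a * U + a ^ 2 * L ^ 2 / 2)) +
      8 * L ^ 2 * (Real.sqrt (2 * π) * (Real.sqrt 2 * L) *
        Real.exp (a * U + a ^ 2 * (Real.sqrt 2 * L) ^ 2 / 2)) := by
  have hL' : 0 < Real.sqrt 2 * L := by positivity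
  -- the majorant
  set g : ℝ → ℝ := fun u ↦ 2 * U ^ 2 * (Real.exp (a * u) * Real.exp (-(u - U) ^ 2 / (2 * L ^ 2))) +
    8 * L ^ 2 * (Real.exp (a * u) * Real.exp (-(u - U) ^ 2 / (2 * (Real.sqrt 2 * L) ^ 2))) with hg
  have hgint : Integrable g :=
    ((integrable_exp_mul_gaussian a hL U).const_mul _).add ((integrable_exp_mul_gaussian a hL' U).const_mul _)
  have hsq2 : (Real.sqrt 2 * L) ^ 2 = 2 * L ^ 2 := by
    rw [mul_pow, Real.sq_sqrt (by norm_num)]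
  -- pointwise domination
  have hdom : ∀ u : ℝ, u ^ 2 * Real.exp (a * u) * Real.exp (-(u - U) ^ 2 / (2 * L ^ 2)) ≤ g u := by
    intro u
    have h1 : u ^ 2 ≤ 2 * U ^ 2 + 2 * (u - U) ^ 2 := by nlinarith [sq_nonneg (u - 2 * U), sq_nonneg (u - U - U)]
    have h2 := sq_le_gauss_inv hL (u - U)
    have hE : 0 < Real.exp (a * u) := Real.exp_pos _
    have hG : 0 < Real.exp (-(u - U) ^ 2 / (2 * L ^ 2)) := Real.exp_pos _
    -- `(u-U)² G_L ≤ 4L² G_{√2 L}`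
    have h3 : (u - U) ^ 2 * Real.exp (-(u - U) ^ 2 / (2 * L ^ 2)) ≤
        4 * L ^ 2 * Real.exp (-(u - U) ^ 2 / (2 * (Real.sqrt 2 * L) ^ 2)) := by
      calc (u - U) ^ 2 * Real.exp (-(u - U) ^ 2 / (2 * L ^ 2))
          ≤ (4 * L ^ 2 * Real.exp ((u - U) ^ 2 / (4 * L ^ 2))) * Real.exp (-(u - U) ^ 2 / (2 * L ^ 2)) :=
            mul_le_mul_of_nonneg_right h2 hG.le
        _ = 4 * L ^ 2 * Real.exp (-(u - U) ^ 2 / (2 * (Real.sqrt 2 * L) ^ 2)) := by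
            rw [mul_assoc, ← Real.exp_add, hsq2]
            congr 2
            field_simp
            ring
    rw [hg]
    nlinarith [mul_le_mul_of_nonneg_right h1 (mul_pos hE hG).le,
      mul_le_mul_of_nonneg_left h3 (mul_pos (by norm_num : (0:ℝ) < 2) hE).le]
  have hnn : ∀ u : ℝ, 0 ≤ u ^ 2 * Real.exp (a * u) * Real.exp (-(u - U) ^ 2 / (2 * L ^ 2)) :=
    fun u ↦ by positivity
  have hmeas : AEStronglyMeasurable
      (fun u : ℝ ↦ u ^ 2 * Real.exp (a * u) * Real.exp (-(u - U) ^ 2 / (2 * L ^ 2))) volume :=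
    (Continuous.aestronglyMeasurable (by fun_prop))
  have hint : Integrable (fun u : ℝ ↦ u ^ 2 * Real.exp (a * u) * Real.exp (-(u - U) ^ 2 / (2 * L ^ 2))) :=
    Integrable.mono' hgint hmeas (Eventually.of_forall fun u ↦ by
      rw [Real.norm_of_nonneg (hnn u)]; exact hdom u)
  refine ⟨hint, ?_⟩
  calc ∫ u : ℝ, u ^ 2 * Real.exp (a * u) * Real.exp (-(u - U) ^ 2 / (2 * L ^ 2))
      ≤ ∫ u, g u := integral_mono hint hgint hdom
    _ = 2 * U ^ 2 * (Real.sqrt (2 * π) * L * Real.exp (a * U + a ^ 2 * L ^ 2 / 2)) +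
        8 * L ^ 2 * (Real.sqrt (2 * π) * (Real.sqrt 2 * L) *
          Real.exp (a * U + a ^ 2 * (Real.sqrt 2 * L) ^ 2 / 2)) := by
        rw [hg, integral_add ((integrable_exp_mul_gaussian a hL U).const_mul _)
          ((integrable_exp_mul_gaussian a hL' U).const_mul _), integral_const_mul, integral_const_mul,
          integral_exp_mul_gaussian a hL U, integral_exp_mul_gaussian a hL' U]

end Summit.RiemannHypothesis.RiemannHypothesis.Theorems.DensityLadderSeparatedTowerGaussianReal

end
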